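import Summits.NavierStokesRegularity.NavierStokesRegularity.Theorems.RellichScarScarRigidityPaintedLadderDefect
import Summits.NavierStokesRegularity.NavierStokesRegularity.Theorems.RellichScarScarRigidityVorticityDefectIBP
import Literature.Analysis.FluidPDE.WholeSpaceIBPIntegrable
import HarnessLib

/-!
# `ScarRigidity`, line `moment-conditioned-rellich` — stub `stub_paintedLadderHigher` (PL≥2), part 7:
# the moments of the source of the pressure difference are radiative moments

Crux stmt-NavierStokesRegularity-11717 (route RellichScar), helper file (`--supports`) for the registered stub
`stub_paintedLadderHigher`.  On a slice `t < 0` the source of the pressure Poisson equation of the difference is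
`g = div X`, `X = (w·∇)V₁ + (V₂·∇)w`, `w = V₁ − V₂` (part 2).  For a smooth weight `H` of controlled growth
(`|H| ≲ (1+‖y‖)^N`, `‖DH‖, ‖D²H‖ ≲ (1+‖y‖)^d`, `d + 1 ≤ N`) two integrations by parts on the whole space — the
divergence theorem in `L¹` form (`integral_mul_divergence_add_eq_zero_of_integrable`), first for `H X`, then for
`DH(V₁) w` and `DH(w) V₂` using `div w = div V₂ = 0` — give

  `∫ H g = −∫ DH(X) = ∫ D²H(w, V₁) + D²H(V₂, w) = ∫ momentIntegrand H V₁ V₂ t`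

(`integral_mul_pressureDiffSource_eq_integral_momentIntegrand`), since
`Σᵢⱼ ((V₁)ᵢ(V₁)ⱼ − (V₂)ᵢ(V₂)ⱼ) ∂ᵢ∂ⱼH = D²H(V₁,V₁) − D²H(V₂,V₂) = D²H(w,V₁) + D²H(V₂,w)`.  All integrals converge
absolutely under flatness of order `N + 2` (the decay of part 2).  With `H` a solid harmonic this identifies the
multipole coefficients of the pressure difference with the radiative moments of the line.
-/

noncomputable section

open Set Filter Function MeasureTheory Metric TopologicalSpace
open scoped Topology ContDiff Laplacian InnerProductSpace RealInnerProductSpace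
open Literature.Analysis.FluidPDE

set_option linter.dupNamespace false -- D-0017: `Summit.<S>.<S>.…` repeats the summit name by design

-- nested operator types
set_option maxSynthPendingDepth 4

namespace Summit.NavierStokesRegularity.NavierStokesRegularity.Theorems.RellichScarScarRigidity

/-! ### Two integrations by parts on the whole space -/

section IBP

variable {H : EuclideanSpace ℝ (Fin 3) → ℝ} {X u v : EuclideanSpace ℝ (Fin 3) → EuclideanSpace ℝ (Fin 3)}

/-- **`∫ H div X = −∫ DH(X)`** on `ℝ³` for `H, X ∈ C¹` with `H X`, `H div X`, `DH(X)` integrable. [folklore] -/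
theorem integral_mul_divergence_eq_neg (hH : ContDiff ℝ 1 H) (hX : ContDiff ℝ 1 X)
    (h1 : Integrable (fun y => H y • X y) volume) (h2 : Integrable (fun y => H y * VectorCalculus.divergence X y) volume)
    (h3 : Integrable (fun y => fderiv ℝ H y (X y)) volume) :
    ∫ y, H y * VectorCalculus.divergence X y = -∫ y, fderiv ℝ H y (X y) := by
  have e : (fun y => ⟪X y, gradient H y⟫) = fun y => fderiv ℝ H y (X y) := by
    funext y; rw [real_inner_comm, gradient, InnerProductSpace.toDual_symm_apply]
  have h := integral_mul_divergence_add_eq_zero_of_integrable hH hX h1 h2 (by rw [e]; exact h3)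
  rw [e] at h
  linarith

/-- **`∫ DH((u·∇)v) = −∫ D²H(u, v)`** on `ℝ³` for `H ∈ C²`, `u, v ∈ C¹`, `div u = 0`, with `DH(v) u`, `D²H(u,v)`,
`DH((u·∇)v)` integrable (`div(DH(v) u) = D²H(u,v) + DH((u·∇)v)`). [folklore] -/
theorem integral_fderiv_convect_eq_neg (hH : ContDiff ℝ 2 H) (hu : ContDiff ℝ 1 u) (hv : ContDiff ℝ 1 v)
    (hdiv : VectorCalculus.IsDivFree u) (h1 : Integrable (fun y => (fderiv ℝ H y (v y)) • u y) volume)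
    (h2 : Integrable (fun y => fderiv ℝ (fderiv ℝ H) y (u y) (v y)) volume)
    (h3 : Integrable (fun y => fderiv ℝ H y (fderiv ℝ v y (u y))) volume) :
    ∫ y, fderiv ℝ H y (fderiv ℝ v y (u y)) = -∫ y, fderiv ℝ (fderiv ℝ H) y (u y) (v y) := by
  have hDH : ContDiff ℝ 1 (fderiv ℝ H) := hH.fderiv_right (m := 1) le_rfl
  set θ : EuclideanSpace ℝ (Fin 3) → ℝ := fun y => fderiv ℝ H y (v y) with hθ_def
  have hθ : ContDiff ℝ 1 θ := hDH.clm_apply hv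
  have hDθ : ∀ y, fderiv ℝ θ y (u y) = fderiv ℝ (fderiv ℝ H) y (u y) (v y) + fderiv ℝ H y (fderiv ℝ v y (u y)) := by
    intro y
    rw [hθ_def, fderiv_clm_apply (hDH.differentiable one_ne_zero y) (hv.differentiable one_ne_zero y)]
    simp only [add_apply, ContinuousLinearMap.comp_apply, ContinuousLinearMap.flip_apply]
    ring
  have e : (fun y => ⟪u y, gradient θ y⟫) = fun y =>
      fderiv ℝ (fderiv ℝ H) y (u y) (v y) + fderiv ℝ H y (fderiv ℝ v y (u y)) := by
    funext y; rw [real_inner_comm, gradient, InnerProductSpace.toDual_symm_apply, hDθ]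
  have h0 : (fun y => θ y * VectorCalculus.divergence u y) = fun _ => 0 := by funext y; rw [hdiv y, mul_zero]
  have h := integral_mul_divergence_add_eq_zero_of_integrable hθ hu h1 (by rw [h0]; exact integrable_zero _ _ _)
    (by rw [e]; exact h2.add h3)
  rw [e, h0, integral_zero, zero_add, integral_add h2 h3] at h
  linarith

end IBP

/-! ### Bilinear forms in coordinates -/

/-- A continuous bilinear form on `ℝ³` in coordinates: `B a b = Σᵢⱼ aᵢ bⱼ B eᵢ eⱼ`. [folklore] -/
theorem bilinear_apply_eq_sum (B : EuclideanSpace ℝ (Fin 3) →L[ℝ] EuclideanSpace ℝ (Fin 3) →L[ℝ] ℝ)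
    (a b : EuclideanSpace ℝ (Fin 3)) :
    B a b = ∑ i : Fin 3, ∑ j : Fin 3, a i * b j * B (EuclideanSpace.single i (1 : ℝ)) (EuclideanSpace.single j (1 : ℝ)) := by
  set e := EuclideanSpace.basisFun (Fin 3) ℝ with he
  have ha : a = ∑ i, a i • (EuclideanSpace.single i (1 : ℝ) : EuclideanSpace ℝ (Fin 3)) := by
    conv_lhs => rw [← e.sum_repr a]
    simp [he]
  have hb : b = ∑ j, b j • (EuclideanSpace.single j (1 : ℝ) : EuclideanSpace ℝ (Fin 3)) := by
    conv_lhs => rw [← e.sum_repr b]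
    simp [he]
  conv_lhs => rw [ha, hb]
  simp only [map_sum, map_smul, FunLike.coe_sum, FunLike.coe_smul, Finset.sum_apply,
    Pi.smul_apply, smul_eq_mul, Finset.mul_sum]
  rw [Finset.sum_comm]
  refine Finset.sum_congr rfl fun i _ => Finset.sum_congr rfl fun j _ => ?_
  ring

/-! ### The slice identity -/

section Twins

variable {V₁ V₂ : ℝ → EuclideanSpace ℝ (Fin 3) → EuclideanSpace ℝ (Fin 3)}
  {Q₁ Q₂ : ℝ → EuclideanSpace ℝ (Fin 3) → ℝ}

/-- **The radiative moment integrand through the Hessian**: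
`momentIntegrand H V₁ V₂ t y = D²H(y)(w, V₁) + D²H(y)(V₂, w)`, `w = V₁(t) − V₂(t)`. [folklore] -/
theorem momentIntegrand_eq_hessian (H : EuclideanSpace ℝ (Fin 3) → ℝ) (V₁ V₂ : ℝ → EuclideanSpace ℝ (Fin 3) → EuclideanSpace ℝ (Fin 3))
    (t : ℝ) (y : EuclideanSpace ℝ (Fin 3)) :
    momentIntegrand H V₁ V₂ t y = fderiv ℝ (fderiv ℝ H) y (V₁ t y - V₂ t y) (V₁ t y) +
      fderiv ℝ (fderiv ℝ H) y (V₂ t y) (V₁ t y - V₂ t y) := by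
  set B := fderiv ℝ (fderiv ℝ H) y with hB
  have e1 : momentIntegrand H V₁ V₂ t y = B (V₁ t y) (V₁ t y) - B (V₂ t y) (V₂ t y) := by
    rw [bilinear_apply_eq_sum, bilinear_apply_eq_sum, ← Finset.sum_sub_distrib]
    unfold momentIntegrand
    refine Finset.sum_congr rfl fun i _ => ?_
    rw [← Finset.sum_sub_distrib]
    refine Finset.sum_congr rfl fun j _ => ?_
    rw [iteratedFDeriv_two_apply]
    simp only [Matrix.cons_val_zero, Matrix.cons_val_one]
    ring
  rw [e1, map_sub, map_sub, sub_apply]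
  ring

/-- From `(1 + ‖y‖)`-weights to apex weights: `(1 + ‖y‖)ᵉ ≤ κᵉ (‖y‖ + a)ᵉ`, `κ = max 1 a⁻¹` (`a > 0`). [folklore] -/
theorem one_add_norm_pow_le {a : ℝ} (ha : 0 < a) (e : ℕ) (y : EuclideanSpace ℝ (Fin 3)) :
    (1 + ‖y‖) ^ e ≤ (max 1 a⁻¹) ^ e * (‖y‖ + a) ^ e := by
  rw [← mul_pow]
  refine pow_le_pow_left₀ (by positivity) ?_ e
  have h1 : 1 ≤ max 1 a⁻¹ * a := by
    calc (1 : ℝ) = a⁻¹ * a := (inv_mul_cancel₀ ha.ne').symm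
      _ ≤ max 1 a⁻¹ * a := mul_le_mul_of_nonneg_right (le_max_right _ _) ha.le
  have h2 : ‖y‖ ≤ max 1 a⁻¹ * ‖y‖ := le_mul_of_one_le_left (norm_nonneg _) (le_max_left _ _)
  nlinarith

/-- **Integrability from a weighted product bound**: a continuous `f` with
`‖f(y)‖ ≤ K (1+‖y‖)ᵈ/(‖y‖+a)^{d+p}`, `p ≥ 4`, is integrable on `ℝ³`. [folklore] -/
theorem integrable_of_weighted_bound {E' : Type*} [NormedAddCommGroup E'] {f : EuclideanSpace ℝ (Fin 3) → E'}
    (hf : Continuous f) {a : ℝ} (ha : 0 < a) {d p : ℕ} (hp : 4 ≤ p) {K : ℝ} (hK : 0 ≤ K)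
    (h : ∀ y, ‖f y‖ ≤ K * (1 + ‖y‖) ^ d / (‖y‖ + a) ^ (d + p)) : Integrable f volume := by
  refine integrable_of_norm_le_apexWeight hf.aestronglyMeasurable ha hp (C := K * (max 1 a⁻¹) ^ d) fun y => ?_
  have hρ : 0 < ‖y‖ + a := by positivity
  refine (h y).trans ?_
  rw [pow_add, div_mul_eq_div_div, div_le_div_iff_of_pos_right (pow_pos hρ _), div_le_iff₀ (pow_pos hρ _), mul_assoc]
  exact mul_le_mul_of_nonneg_left (one_add_norm_pow_le ha d y) hK

/-- **The moments of the source are radiative moments.**  For two classical Navier–Stokes pairs on the open backward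
slab with the scale-invariant packages and flatness of order `N + 2`, a slice `t < 0`, and a smooth weight `H` with
`|H(y)| ≤ C(1+‖y‖)^N`, `‖DH(y)‖ ≤ C(1+‖y‖)ᵈ`, `‖D²H(y)‖ ≤ C(1+‖y‖)ᵈ`, `d + 1 ≤ N`: the moment of the source
`g = div((w·∇)V₁ + (V₂·∇)w)` against `H` converges absolutely and equals the radiative moment,
`∫ H g = ∫ momentIntegrand H V₁ V₂ t` (two integrations by parts). [folklore] -/
theorem integral_mul_pressureDiffSource_eq_integral_momentIntegrand
    (hcl₁ : IsClassicalNSSolutionOn (Iio (0 : ℝ)) 1 0 V₁ Q₁) (hcl₂ : IsClassicalNSSolutionOn (Iio (0 : ℝ)) 1 0 V₂ Q₂)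
    (hB₁ : ScaleInvariantBounds V₁ Q₁) (hB₂ : ScaleInvariantBounds V₂ Q₂) (N : ℕ) (hF : FarDecay (N + 2) V₁ V₂)
    {t : ℝ} (ht : t < 0) {H : EuclideanSpace ℝ (Fin 3) → ℝ} (hH : ContDiff ℝ ∞ H) {C : ℝ} {d : ℕ} (hd : d + 1 ≤ N)
    (hH0 : ∀ y, |H y| ≤ C * (1 + ‖y‖) ^ N) (hH1 : ∀ y, ‖fderiv ℝ H y‖ ≤ C * (1 + ‖y‖) ^ d)
    (hH2 : ∀ y, ‖fderiv ℝ (fderiv ℝ H) y‖ ≤ C * (1 + ‖y‖) ^ d) :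
    Integrable (fun y => H y * VectorCalculus.divergence (fun y => convect (fun z => V₁ t z - V₂ t z) (V₁ t) y +
        convect (V₂ t) (fun z => V₁ t z - V₂ t z) y) y) volume ∧
      Integrable (momentIntegrand H V₁ V₂ t) volume ∧
        ∫ y, H y * VectorCalculus.divergence (fun y => convect (fun z => V₁ t z - V₂ t z) (V₁ t) y +
            convect (V₂ t) (fun z => V₁ t z - V₂ t z) y) y = ∫ y, momentIntegrand H V₁ V₂ t y := by
  obtain ⟨e₀, he₀⟩ := Nat.exists_eq_add_of_le hd
  have hσ : 0 < Real.sqrt (-t) := Real.sqrt_pos.2 (by linarith)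
  set a : ℝ := Real.sqrt (-t) with ha_def
  have hC : 0 ≤ C := by
    have := (abs_nonneg _).trans (hH0 0)
    rw [norm_zero, add_zero, one_pow, mul_one] at this
    exact this
  -- the fields on the slice
  set w : EuclideanSpace ℝ (Fin 3) → EuclideanSpace ℝ (Fin 3) := fun z => V₁ t z - V₂ t z with hw_def
  set X : EuclideanSpace ℝ (Fin 3) → EuclideanSpace ℝ (Fin 3) := fun y => convect w (V₁ t) y + convect (V₂ t) w y
    with hX_def
  have hV₁ : ContDiff ℝ ∞ (V₁ t) := hcl₁.contDiff_velocity ht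
  have hV₂ : ContDiff ℝ ∞ (V₂ t) := hcl₂.contDiff_velocity ht
  have hw : ContDiff ℝ ∞ w := hV₁.sub hV₂
  have hX : ContDiff ℝ ∞ X := contDiff_defectFlux_slice hcl₁ hcl₂ ht
  have hg : ContDiff ℝ ∞ (VectorCalculus.divergence X) := contDiff_divergence_of_smooth hX
  have hDH : ContDiff ℝ ∞ (fderiv ℝ H) := hH.fderiv_right (m := ∞) le_rfl
  have hD2H : ContDiff ℝ ∞ (fderiv ℝ (fderiv ℝ H)) := hDH.fderiv_right (m := ∞) le_rfl
  have hdivw : VectorCalculus.IsDivFree w := fun y => by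
    rw [hw_def, divergence_sub_apply (hV₁.differentiable (by simp) y) (hV₂.differentiable (by simp) y),
      hcl₁.divFree t ht y, hcl₂.divFree t ht y, sub_zero]
  -- decay on the slice
  obtain ⟨W, hW0, hW⟩ := exists_global_flatness hcl₁.smooth_velocity hcl₂.smooth_velocity hB₁ hB₂ N hF 1
  obtain ⟨L, hL0, hL⟩ := exists_twin_velocity_bounds hB₁ hB₂ 1
  obtain ⟨CX, hCX0, hCX⟩ := exists_defectFlux_bound hcl₁ hcl₂ hB₁ hB₂ N hF 0
  obtain ⟨Cg, hCg0, hCg⟩ := exists_pressureDiffSource_bound hcl₁ hcl₂ hB₁ hB₂ N hF 0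
  set A : ℝ := W * a⁻¹ * a ^ (N + 2) with hA
  have hA0 : 0 ≤ A := by positivity
  have hw0 : ∀ y, ‖w y‖ ≤ A / (‖y‖ + a) ^ (N + 2) := fun y => by
    have h := hW 0 (by norm_num) t ht y; rwa [norm_iteratedFDeriv_zero, add_zero] at h
  have hw1 : ∀ y, ‖fderiv ℝ w y‖ ≤ A / (‖y‖ + a) ^ (N + 3) := fun y => by
    have h := hW 1 le_rfl t ht y; rwa [← norm_iteratedFDeriv_fderiv, norm_iteratedFDeriv_zero] at h
  have hU0 : ∀ y, ‖V₁ t y‖ ≤ L / (‖y‖ + a) ^ 1 ∧ ‖V₂ t y‖ ≤ L / (‖y‖ + a) ^ 1 := fun y => by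
    have h := hL 0 (by norm_num) t ht y; simp only [norm_iteratedFDeriv_zero, add_zero] at h; exact h
  have hU1 : ∀ y, ‖fderiv ℝ (V₁ t) y‖ ≤ L / (‖y‖ + a) ^ 2 := fun y => by
    have h := (hL 1 le_rfl t ht y).1; rwa [← norm_iteratedFDeriv_fderiv, norm_iteratedFDeriv_zero] at h
  set KX : ℝ := CX * a⁻¹ * a ^ (N + 2) with hKX
  have hKX0 : 0 ≤ KX := by positivity
  have hXb : ∀ y, ‖X y‖ ≤ KX / (‖y‖ + a) ^ (N + 4) := fun y => by
    have h := hCX t ht y; rwa [norm_iteratedFDeriv_zero, add_zero] at h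
  set Kg : ℝ := Cg * a⁻¹ * a ^ (N + 2) with hKg
  have hKg0 : 0 ≤ Kg := by positivity
  have hgb : ∀ y, ‖VectorCalculus.divergence X y‖ ≤ Kg / (‖y‖ + a) ^ (N + 5) := fun y => by
    have h := hCg t ht y; rwa [norm_iteratedFDeriv_zero, add_zero] at h
  have hρ : ∀ y : EuclideanSpace ℝ (Fin 3), 0 < ‖y‖ + a := fun y => by positivity
  -- product bounds: `P (1+‖y‖)^e · Q/ρ^i · R/ρ^j = PQR (1+‖y‖)^e/ρ^{i+j}`
  have prod3 : ∀ {e i j : ℕ} {P Q R p q r : ℝ} (y : EuclideanSpace ℝ (Fin 3)), 0 ≤ p → 0 ≤ q → 0 ≤ r → 0 ≤ Q → 0 ≤ R →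
      p ≤ P * (1 + ‖y‖) ^ e → q ≤ Q / (‖y‖ + a) ^ i → r ≤ R / (‖y‖ + a) ^ j →
      p * q * r ≤ P * Q * R * (1 + ‖y‖) ^ e / (‖y‖ + a) ^ (i + j) := by
    intro e i j P Q R p q r y hp hq hr hQ hR h1 h2 h3
    calc p * q * r ≤ (P * (1 + ‖y‖) ^ e) * (Q / (‖y‖ + a) ^ i) * (R / (‖y‖ + a) ^ j) :=
          mul_le_mul (mul_le_mul h1 h2 hq ((hp.trans h1))) h3 hr
            (mul_nonneg (hp.trans h1) (div_nonneg hQ (pow_nonneg (hρ y).le _)))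
      _ = P * Q * R * (1 + ‖y‖) ^ e / (‖y‖ + a) ^ (i + j) := by rw [pow_add]; field_simp
  have prod2 : ∀ {e i : ℕ} {P Q p q : ℝ} (y : EuclideanSpace ℝ (Fin 3)), 0 ≤ p → 0 ≤ q →
      p ≤ P * (1 + ‖y‖) ^ e → q ≤ Q / (‖y‖ + a) ^ i → p * q ≤ P * Q * (1 + ‖y‖) ^ e / (‖y‖ + a) ^ i := by
    intro e i P Q p q y hp hq h1 h2
    calc p * q ≤ (P * (1 + ‖y‖) ^ e) * (Q / (‖y‖ + a) ^ i) := mul_le_mul h1 h2 hq (hp.trans h1)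
      _ = P * Q * (1 + ‖y‖) ^ e / (‖y‖ + a) ^ i := by field_simp
  -- (i1) `H X`
  have i1 : Integrable (fun y => H y • X y) volume := by
    refine integrable_of_weighted_bound (hH.continuous.smul hX.continuous) hσ (d := N) (p := 4) le_rfl
      (K := C * KX) (by positivity) fun y => ?_
    rw [norm_smul, Real.norm_eq_abs]
    exact prod2 y (abs_nonneg _) (norm_nonneg _) (hH0 y) (hXb y)
  -- (i2) `H g`
  have i2 : Integrable (fun y => H y * VectorCalculus.divergence X y) volume := by
    refine integrable_of_weighted_bound (hH.continuous.mul hg.continuous) hσ (d := N) (p := 5) (by norm_num)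
      (K := C * Kg) (by positivity) fun y => ?_
    rw [norm_mul, Real.norm_eq_abs]
    exact prod2 y (abs_nonneg _) (norm_nonneg _) (hH0 y) (hgb y)
  -- (i3) `DH(X)`
  have i3 : Integrable (fun y => fderiv ℝ H y (X y)) volume := by
    refine integrable_of_weighted_bound (hDH.continuous.clm_apply hX.continuous) hσ (d := d) (p := e₀ + 5) (by omega)
      (K := C * KX) (by positivity) fun y => ?_
    rw [show d + (e₀ + 5) = N + 4 by omega]
    exact (ContinuousLinearMap.le_opNorm _ _).trans (prod2 y (norm_nonneg _) (norm_nonneg _) (hH1 y) (hXb y))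
  -- (i4) `DH(V₁) w`, (i6) `D²H(w, V₁)`, (i8) `DH(DV₁ w)`
  have i4 : Integrable (fun y => (fderiv ℝ H y (V₁ t y)) • w y) volume := by
    refine integrable_of_weighted_bound ((hDH.continuous.clm_apply hV₁.continuous).smul hw.continuous) hσ (d := d)
      (p := e₀ + 4) (by omega) (K := C * L * A) (by positivity) fun y => ?_
    rw [norm_smul, show d + (e₀ + 4) = 1 + (N + 2) by omega]
    refine (mul_le_mul_of_nonneg_right (ContinuousLinearMap.le_opNorm _ _) (norm_nonneg _)).trans ?_
    exact prod3 y (norm_nonneg _) (norm_nonneg _) (norm_nonneg _) hL0 hA0 (hH1 y) (hU0 y).1 (hw0 y)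
  have i6 : Integrable (fun y => fderiv ℝ (fderiv ℝ H) y (w y) (V₁ t y)) volume := by
    refine integrable_of_weighted_bound ((hD2H.continuous.clm_apply hw.continuous).clm_apply hV₁.continuous) hσ
      (d := d) (p := e₀ + 4) (by omega) (K := C * A * L) (by positivity) fun y => ?_
    rw [show d + (e₀ + 4) = (N + 2) + 1 by omega]
    refine ((ContinuousLinearMap.le_opNorm _ _).trans (mul_le_mul_of_nonneg_right (ContinuousLinearMap.le_opNorm _ _)
      (norm_nonneg _))).trans ?_
    exact prod3 y (norm_nonneg _) (norm_nonneg _) (norm_nonneg _) hA0 hL0 (hH2 y) (hw0 y) (hU0 y).1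
  have i8 : Integrable (fun y => fderiv ℝ H y (fderiv ℝ (V₁ t) y (w y))) volume := by
    refine integrable_of_weighted_bound (hDH.continuous.clm_apply
      ((hV₁.continuous_fderiv (by simp)).clm_apply hw.continuous)) hσ (d := d) (p := e₀ + 5) (by omega)
      (K := C * L * A) (by positivity) fun y => ?_
    rw [show d + (e₀ + 5) = 2 + (N + 2) by omega]
    refine ((ContinuousLinearMap.le_opNorm _ _).trans (mul_le_mul_of_nonneg_left (ContinuousLinearMap.le_opNorm _ _)
      (norm_nonneg _))).trans ?_
    rw [← mul_assoc]
    exact prod3 y (norm_nonneg _) (norm_nonneg _) (norm_nonneg _) hL0 hA0 (hH1 y) (hU1 y) (hw0 y)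
  -- (i5) `DH(w) V₂`, (i7) `D²H(V₂, w)`, (i9) `DH(Dw V₂)`
  have i5 : Integrable (fun y => (fderiv ℝ H y (w y)) • V₂ t y) volume := by
    refine integrable_of_weighted_bound ((hDH.continuous.clm_apply hw.continuous).smul hV₂.continuous) hσ (d := d)
      (p := e₀ + 4) (by omega) (K := C * A * L) (by positivity) fun y => ?_
    rw [norm_smul, show d + (e₀ + 4) = (N + 2) + 1 by omega]
    refine (mul_le_mul_of_nonneg_right (ContinuousLinearMap.le_opNorm _ _) (norm_nonneg _)).trans ?_
    exact prod3 y (norm_nonneg _) (norm_nonneg _) (norm_nonneg _) hA0 hL0 (hH1 y) (hw0 y) (hU0 y).2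
  have i7 : Integrable (fun y => fderiv ℝ (fderiv ℝ H) y (V₂ t y) (w y)) volume := by
    refine integrable_of_weighted_bound ((hD2H.continuous.clm_apply hV₂.continuous).clm_apply hw.continuous) hσ
      (d := d) (p := e₀ + 4) (by omega) (K := C * L * A) (by positivity) fun y => ?_
    rw [show d + (e₀ + 4) = 1 + (N + 2) by omega]
    refine ((ContinuousLinearMap.le_opNorm _ _).trans (mul_le_mul_of_nonneg_right (ContinuousLinearMap.le_opNorm _ _)
      (norm_nonneg _))).trans ?_
    exact prod3 y (norm_nonneg _) (norm_nonneg _) (norm_nonneg _) hL0 hA0 (hH2 y) (hU0 y).2 (hw0 y)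
  have i9 : Integrable (fun y => fderiv ℝ H y (fderiv ℝ w y (V₂ t y))) volume := by
    refine integrable_of_weighted_bound (hDH.continuous.clm_apply
      ((hw.continuous_fderiv (by simp)).clm_apply hV₂.continuous)) hσ (d := d) (p := e₀ + 5) (by omega)
      (K := C * A * L) (by positivity) fun y => ?_
    rw [show d + (e₀ + 5) = (N + 3) + 1 by omega]
    refine ((ContinuousLinearMap.le_opNorm _ _).trans (mul_le_mul_of_nonneg_left (ContinuousLinearMap.le_opNorm _ _)
      (norm_nonneg _))).trans ?_
    rw [← mul_assoc]
    exact prod3 y (norm_nonneg _) (norm_nonneg _) (norm_nonneg _) hA0 hL0 (hH1 y) (hw1 y) (hU0 y).2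
  -- the two integrations by parts
  have hH1' : ContDiff ℝ 1 H := hH.of_le (by norm_cast)
  have hH2' : ContDiff ℝ 2 H := hH.of_le (by norm_cast)
  have step1 := integral_mul_divergence_eq_neg hH1' (hX.of_le (by norm_cast)) i1 i2 i3
  have step2a := integral_fderiv_convect_eq_neg hH2' (hw.of_le (by norm_cast)) (hV₁.of_le (by norm_cast)) hdivw i4 i6 i8
  have step2b := integral_fderiv_convect_eq_neg hH2' (hV₂.of_le (by norm_cast)) (hw.of_le (by norm_cast))
    (hcl₂.divFree t ht) i5 i7 i9
  have hsplit : ∫ y, fderiv ℝ H y (X y) = (∫ y, fderiv ℝ H y (fderiv ℝ (V₁ t) y (w y))) +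
      ∫ y, fderiv ℝ H y (fderiv ℝ w y (V₂ t y)) := by
    rw [← integral_add i8 i9]
    refine integral_congr_ae (Eventually.of_forall fun y => ?_)
    simp only [hX_def, convect_apply, map_add]
  -- the moment integrand
  have hmI : momentIntegrand H V₁ V₂ t = fun y => fderiv ℝ (fderiv ℝ H) y (w y) (V₁ t y) +
      fderiv ℝ (fderiv ℝ H) y (V₂ t y) (w y) := funext fun y => momentIntegrand_eq_hessian H V₁ V₂ t y
  refine ⟨i2, by rw [hmI]; exact i6.add i7, ?_⟩
  rw [hmI, integral_add i6 i7, step1, hsplit, step2a, step2b]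
  ring

end Twins

/-! ### Registered sub-goal -/

/-- **Registered helper stub `stub_paintedLadderMomentIdentityTools`** of `stub_paintedLadderHigher` (crux
stmt-NavierStokesRegularity-11717, line `moment-conditioned-rellich`): on every slice the moments of the source of the
pressure Poisson equation of the difference against a smooth weight of controlled growth are the radiative moments of
the line, `∫ H g = ∫ momentIntegrand H V₁ V₂ t`, with absolute convergence. [folklore] -/
theorem stub_paintedLadderMomentIdentityTools :
    ∀ (V₁ V₂ : ℝ → EuclideanSpace ℝ (Fin 3) → EuclideanSpace ℝ (Fin 3)) (Q₁ Q₂ : ℝ → EuclideanSpace ℝ (Fin 3) → ℝ), IsClassicalNSSolutionOn (Iio (0 : ℝ)) 1 0 V₁ Q₁ → IsClassicalNSSolutionOn (Iio (0 : ℝ)) 1 0 V₂ Q₂ → ScaleInvariantBounds V₁ Q₁ → ScaleInvariantBounds V₂ Q₂ → ∀ N : ℕ, FarDecay (N + 2) V₁ V₂ → ∀ t : ℝ, t < 0 → ∀ (H : EuclideanSpace ℝ (Fin 3) → ℝ), ContDiff ℝ (⊤ : ℕ∞) H → ∀ (C : ℝ) (d : ℕ), d + 1 ≤ N → (∀ y,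 |H y| ≤ C * (1 + ‖y‖) ^ N) → (∀ y, ‖fderiv ℝ H y‖ ≤ C * (1 + ‖y‖) ^ d) → (∀ y, ‖fderiv ℝ (fderiv ℝ H) y‖ ≤ C * (1 + ‖y‖) ^ d) → Integrable (fun y => H y * VectorCalculus.divergence (fun y => convect (fun z => V₁ t z - V₂ t z) (V₁ t) y + convect (V₂ t) (fun z => V₁ t z - V₂ t z) y) y) volume ∧ Integrable (momentIntegrand H V₁ V₂ t) volume ∧ ∫ y, H y * VectorCalculus.divergence (fun y => convect (fun z => V₁ t z - V₂ t z) (V₁ t) y + convect (V₂ t) (fun z => V₁ t z - V₂ t z) y) y = ∫ y, momentIntegrand H V₁ V₂ t y :=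
  fun _V₁ _V₂ _Q₁ _Q₂ hcl₁ hcl₂ hB₁ hB₂ N hF _t ht _H hH _C _d hd hH0 hH1 hH2 =>
    integral_mul_pressureDiffSource_eq_integral_momentIntegrand hcl₁ hcl₂ hB₁ hB₂ N hF ht hH hd hH0 hH1 hH2

end Summit.NavierStokesRegularity.NavierStokesRegularity.Theorems.RellichScarScarRigidity

end
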